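import Summits.CriticalPhenomena.PercolationContinuityZ3.Theses.PercNearOneGluing
import Summits.CriticalPhenomena.PercolationContinuityZ3.Theorems.PercNearOneGluingAdditiveGluingThreePointTransfer
import Literature.Probability.Percolation.TwoSetExchange
import Literature.Probability.Percolation.KozmaNitzanPreFKG
import HarnessLib

/-!
# Crux `PercNearOneGluing.AdditiveGluing` (stmt-CriticalPhenomena-4576), line `tieline`: the four-point transfer
# (registered stub `stub_fourPointTransfer_c11`)

Support file (`--supports stmt-CriticalPhenomena-4576`, lead c11).  No definitions, no named facts, no sorries.

Weighted graph on `Fin n` (`μ = prodBernoulli w`), relays `u, v`, observer `o`, spectator `c`; `D = {u ↮ v}`,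
`F = D ∩ {c ↮ u}`, `T3 = D ∩ {c ↮ u} ∩ {c ↮ v}` (`u, v, c` pairwise separated), `Dcu = D ∩ {c ↔ u}`.
The registered stub is the instance "`b` pendant to `c`" of the kernel (T_D) of the three-relay half:

  `P(o ↔ {v, c} | u ↮ {v, c}) ≥ P(o ↔ c | T3) + P(o ↔ v | u ↮ v, u ↔ c)`,

in the division-free form
`μ(T3 ∩ {o↔c})·μ(F)·μ(Dcu) + μ(Dcu ∩ {v↔o})·μ(F)·μ(T3) ≤ μ(F ∩ ({v↔o} ∪ {o↔c}))·μ(T3)·μ(Dcu)`.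

Proof.  (i) The three-point transfer `threePointTransfer` (3PT, landed):
`μ(T3 ∩ oc)·μ(D ∩ vc)·μ(D ∩ vcᶜ) ≤ μ(T3)·(μ(D)·μ(D ∩ vo ∩ vc) − μ(D ∩ vo)·μ(D ∩ vc))`.
(ii) One guarded two-cluster exchange (van den Berg–Häggström–Kahn, Thm. 2.1 at `q = 1`, tree
`guardedTwoClusterExchange`) for `S = {v}`, `T = {u, c}`, pair `(v, u)`: `{v ↔ o}` is of type `(+)` and `{u ↔ c}` of
type `(−)`, whence `P(v ↔ o | D, c ↔ u) ≤ P(v ↔ o | T3)` (step (Q)).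
(iii) The set identities `μ(F) = μ(D ∩ vc) + μ(T3)`, `μ(D ∩ vcᶜ) = μ(Dcu) + μ(T3)`,
`μ(D ∩ vcᶜ ∩ vo) = μ(Dcu ∩ vo) + μ(T3 ∩ vo)`, `μ(F ∩ (vo ∪ oc)) ≥ μ(D ∩ vo ∩ vc) + μ(T3 ∩ vo) + μ(T3 ∩ oc)`
(from the 3PT file), and linear arithmetic: with `t = μ(T3)`, `g = μ(Dcu)`,
`(t + g)·(goal slack) = g·(3PT slack) + t·(t + g + μ(D ∩ vc))·((Q) slack) + (t+g)·t·g·(obs slack)`.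
[cite: VandenbergHaggstromKahn2005, Thm. 1.3 (p. 6), Thm. 1.5 (p. 7), Thm. 2.1 (p. 9) with Remark 1 after Thm. 1.2 (p. 5)]
[cite: KozmaNitzan2024, Lemma 4 (p. 9), Question 7 (p. 36)]
-/

namespace Summit.CriticalPhenomena.PercolationContinuityZ3.Cruxes.AdditiveGluing.TieLine

open MeasureTheory Set Literature.Probability.LatticeModels Literature.Probability.Percolation
open Summit.CriticalPhenomena.PercolationContinuityZ3.Theorems

noncomputable section

namespace FourPointTransfer

variable {n : ℕ}

/-! ### Linear arithmetic -/

/-- The arithmetic of the four-point transfer: from (3PT) `h3`, the exchange (Q) `hQ` and the observable lower bound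
`hge` (all in the variables `pvc = μ(D ∩ vc)`, `pocv = μ(D ∩ vo ∩ vc)`, `t = μ(T3)`, `tov = μ(T3 ∩ vo)`,
`toc = μ(T3 ∩ oc)`, `g = μ(Dcu)`, `go = μ(Dcu ∩ vo)`, `obs = μ(F ∩ (vo ∪ oc))`) to the goal; the certificate is
`(t + g)·(goal slack) = g·(h3 slack) + t·(t + g + pvc)·(tov·g − go·t) + (t + g)·t·g·(hge slack)`. [folklore] -/
theorem alg {pvc pocv t tov toc g go obs : ℝ} (ht0 : 0 ≤ t) (hg0 : 0 ≤ g) (hpvc0 : 0 ≤ pvc)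
    (h3 : toc * (pvc * (g + t)) ≤ t * ((pvc + (g + t)) * pocv - (pocv + (go + tov)) * pvc))
    (hQ : go * (g + t) ≤ (go + tov) * g) (hge : pocv + tov + toc ≤ obs) :
    toc * (pvc + t) * g + go * (pvc + t) * t ≤ obs * t * g := by
  have hK : go * t ≤ tov * g := by linarith
  rcases (add_nonneg ht0 hg0).eq_or_lt with htg | htg
  · have ht : t = 0 := by linarith
    have hg : g = 0 := by linarith
    subst ht hg
    simp
  · have key : (t + g) * (toc * (pvc + t) * g + go * (pvc + t) * t) ≤ (t + g) * (obs * t * g) := by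
      nlinarith [mul_le_mul_of_nonneg_left h3 hg0,
        mul_le_mul_of_nonneg_left hK (mul_nonneg ht0 (add_nonneg (add_nonneg ht0 hg0) hpvc0)),
        mul_le_mul_of_nonneg_left hge (mul_nonneg (mul_nonneg (add_nonneg ht0 hg0) ht0) hg0)]
    exact le_of_mul_le_mul_left key htg

/-! ### Set identities -/

/-- `{v↮u} ∩ {v↮c} ∩ ({v↔o} ∩ {u↔c}) = D ∩ {c↔u} ∩ {v↔o}` (`u ↮ v` and `c ↔ u` force `v ↮ c`). [folklore] -/
theorem Q_mid_eq (o u v c : Fin n) :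
    ((openConn v u)ᶜ ∩ (openConn v c)ᶜ ∩ (openConn v o ∩ openConn u c) : Set (BondConfig (Fin n))) =
      (openConn u v)ᶜ ∩ openConn c u ∩ openConn v o := by
  ext ω
  simp only [mem_inter_iff, mem_compl_iff, openConn, mem_setOf_eq]
  constructor
  · rintro ⟨⟨hvu, -⟩, hvo, huc⟩
    exact ⟨⟨fun huv => hvu huv.symm, huc.symm⟩, hvo⟩
  · rintro ⟨⟨huv, hcu⟩, hvo⟩
    exact ⟨⟨fun hvu => huv hvu.symm, fun hvc => huv (hcu.symm.trans hvc.symm)⟩, hvo, hcu.symm⟩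

/-- `{v↮u} ∩ {v↮c} ∩ {u↔c} = D ∩ {c↔u}`. [folklore] -/
theorem Q_right_eq (u v c : Fin n) :
    ((openConn v u)ᶜ ∩ (openConn v c)ᶜ ∩ openConn u c : Set (BondConfig (Fin n))) = (openConn u v)ᶜ ∩ openConn c u := by
  ext ω
  simp only [mem_inter_iff, mem_compl_iff, openConn, mem_setOf_eq]
  constructor
  · rintro ⟨⟨hvu, -⟩, huc⟩
    exact ⟨fun huv => hvu huv.symm, huc.symm⟩
  · rintro ⟨huv, hcu⟩
    exact ⟨⟨fun hvu => huv hvu.symm, fun hvc => huv (hcu.symm.trans hvc.symm)⟩, hcu.symm⟩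

/-- `D ∩ {v↮c} ∩ {c↔u} = D ∩ {c↔u}`. [folklore] -/
theorem cb_cu_eq (u v c : Fin n) :
    ((openConn u v)ᶜ ∩ (openConn v c)ᶜ ∩ openConn c u : Set (BondConfig (Fin n))) = (openConn u v)ᶜ ∩ openConn c u := by
  ext ω
  simp only [mem_inter_iff, mem_compl_iff, openConn, mem_setOf_eq]
  constructor
  · rintro ⟨⟨huv, -⟩, hcu⟩
    exact ⟨huv, hcu⟩
  · rintro ⟨huv, hcu⟩
    exact ⟨⟨huv, fun hvc => huv (hcu.symm.trans hvc.symm)⟩, hcu⟩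

/-- `D ∩ {v↮c} ∩ {c↮u} = T3`. [folklore] -/
theorem cb_free_eq (u v c : Fin n) :
    ((openConn u v)ᶜ ∩ (openConn v c)ᶜ ∩ (openConn c u)ᶜ : Set (BondConfig (Fin n))) =
      (openConn u v)ᶜ ∩ ((openConn c u)ᶜ ∩ (openConn c v)ᶜ) := by
  ext ω
  simp only [mem_inter_iff, mem_compl_iff, openConn, mem_setOf_eq]
  constructor
  · rintro ⟨⟨huv, hvc⟩, hcu⟩
    exact ⟨huv, hcu, fun hcv => hvc hcv.symm⟩
  · rintro ⟨huv, hcu, hcv⟩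
    exact ⟨⟨huv, fun hvc => hcv hvc.symm⟩, hcu⟩

/-- `D ∩ {v↮c} ∩ {v↔o} ∩ {c↔u} = D ∩ {c↔u} ∩ {v↔o}`. [folklore] -/
theorem ocb_cu_eq (o u v c : Fin n) :
    ((openConn u v)ᶜ ∩ (openConn v c)ᶜ ∩ openConn v o ∩ openConn c u : Set (BondConfig (Fin n))) =
      (openConn u v)ᶜ ∩ openConn c u ∩ openConn v o := by
  ext ω
  simp only [mem_inter_iff, mem_compl_iff, openConn, mem_setOf_eq]
  constructor
  · rintro ⟨⟨⟨huv, -⟩, hvo⟩, hcu⟩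
    exact ⟨⟨huv, hcu⟩, hvo⟩
  · rintro ⟨⟨huv, hcu⟩, hvo⟩
    exact ⟨⟨⟨huv, fun hvc => huv (hcu.symm.trans hvc.symm)⟩, hvo⟩, hcu⟩

/-- `D ∩ {v↮c} ∩ {v↔o} ∩ {c↮u} = T3 ∩ {v↔o}`. [folklore] -/
theorem ocb_free_eq (o u v c : Fin n) :
    ((openConn u v)ᶜ ∩ (openConn v c)ᶜ ∩ openConn v o ∩ (openConn c u)ᶜ : Set (BondConfig (Fin n))) =
      (openConn u v)ᶜ ∩ ((openConn c u)ᶜ ∩ (openConn c v)ᶜ) ∩ openConn v o := by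
  ext ω
  simp only [mem_inter_iff, mem_compl_iff, openConn, mem_setOf_eq]
  constructor
  · rintro ⟨⟨⟨huv, hvc⟩, hvo⟩, hcu⟩
    exact ⟨⟨huv, hcu, fun hcv => hvc hcv.symm⟩, hvo⟩
  · rintro ⟨⟨huv, hcu, hcv⟩, hvo⟩
    exact ⟨⟨⟨huv, fun hvc => hcv hvc.symm⟩, hvo⟩, hcu⟩

/-- `F = D ∩ {c↮u} = {v↮u} ∩ {c↮u}`. [folklore] -/
theorem F_eq (u v c : Fin n) :
    ((openConn u v)ᶜ ∩ (openConn c u)ᶜ : Set (BondConfig (Fin n))) = (openConn v u)ᶜ ∩ (openConn c u)ᶜ := by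
  rw [KNPreFKG.openConn_symm u v]

/-- `F ∩ ({v↔o} ∪ {o↔c}) = {v↮u} ∩ {c↮u} ∩ {o ∈ C_{{v,c}}}`. [folklore] -/
theorem obs_eq (o u v c : Fin n) :
    ((openConn u v)ᶜ ∩ (openConn c u)ᶜ ∩ (openConn v o ∪ openConn o c) : Set (BondConfig (Fin n))) =
      (openConn v u)ᶜ ∩ (openConn c u)ᶜ ∩ ⋃ s ∈ ({v, c} : Set (Fin n)), (openConn s o : Set (BondConfig (Fin n))) := by
  ext ω
  simp only [mem_inter_iff, mem_compl_iff, mem_union, mem_iUnion, mem_insert_iff, mem_singleton_iff, exists_prop,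
    openConn, mem_setOf_eq]
  constructor
  · rintro ⟨⟨huv, hcu⟩, h⟩
    refine ⟨⟨fun hvu => huv hvu.symm, hcu⟩, ?_⟩
    rcases h with hvo | hoc
    · exact ⟨v, Or.inl rfl, hvo⟩
    · exact ⟨c, Or.inr rfl, hoc.symm⟩
  · rintro ⟨⟨hvu, hcu⟩, s, hs, hso⟩
    refine ⟨⟨fun huv => hvu huv.symm, hcu⟩, ?_⟩
    rcases hs with rfl | rfl
    · exact Or.inl hso
    · exact Or.inr hso.symm

/-! ### Measure splits -/

/-- `μ(D ∩ {v↮c}) = μ(Dcu) + μ(T3)` (split along `c ↔ u`). [folklore] -/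
theorem real_cb_split (w : Sym2 (Fin n) → unitInterval) (u v c : Fin n) :
    (prodBernoulli w).real ((openConn u v)ᶜ ∩ (openConn v c)ᶜ : Set (BondConfig (Fin n))) =
      (prodBernoulli w).real ((openConn u v)ᶜ ∩ openConn c u : Set (BondConfig (Fin n))) +
        (prodBernoulli w).real ((openConn u v)ᶜ ∩ ((openConn c u)ᶜ ∩ (openConn c v)ᶜ) : Set (BondConfig (Fin n))) := by
  rw [ML5EdgeIdentity.real_eq_inter_add_inter_compl w ((openConn u v)ᶜ ∩ (openConn v c)ᶜ : Set (BondConfig (Fin n)))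
    (openConn c u), cb_cu_eq u v c, cb_free_eq u v c]

/-- `μ(D ∩ {v↮c} ∩ {v↔o}) = μ(Dcu ∩ {v↔o}) + μ(T3 ∩ {v↔o})` (split along `c ↔ u`). [folklore] -/
theorem real_ocb_split (w : Sym2 (Fin n) → unitInterval) (o u v c : Fin n) :
    (prodBernoulli w).real ((openConn u v)ᶜ ∩ (openConn v c)ᶜ ∩ openConn v o : Set (BondConfig (Fin n))) =
      (prodBernoulli w).real ((openConn u v)ᶜ ∩ openConn c u ∩ openConn v o : Set (BondConfig (Fin n))) +
        (prodBernoulli w).real ((openConn u v)ᶜ ∩ ((openConn c u)ᶜ ∩ (openConn c v)ᶜ) ∩ openConn v o :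
          Set (BondConfig (Fin n))) := by
  rw [ML5EdgeIdentity.real_eq_inter_add_inter_compl w
    ((openConn u v)ᶜ ∩ (openConn v c)ᶜ ∩ openConn v o : Set (BondConfig (Fin n))) (openConn c u),
    ocb_cu_eq o u v c, ocb_free_eq o u v c]

/-- `μ(F) = μ(D ∩ {v↔c}) + μ(T3)` (split along `v ↔ c`). [folklore] -/
theorem real_F_split (w : Sym2 (Fin n) → unitInterval) (u v c : Fin n) :
    (prodBernoulli w).real ((openConn u v)ᶜ ∩ (openConn c u)ᶜ : Set (BondConfig (Fin n))) =
      (prodBernoulli w).real ((openConn u v)ᶜ ∩ openConn v c : Set (BondConfig (Fin n))) +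
        (prodBernoulli w).real ((openConn u v)ᶜ ∩ ((openConn c u)ᶜ ∩ (openConn c v)ᶜ) : Set (BondConfig (Fin n))) := by
  rw [F_eq u v c]
  exact ThreePointTransfer.real_I_right_eq w u v c

/-- `μ(F ∩ ({v↔o} ∪ {o↔c})) ≥ μ(D ∩ {v↔o} ∩ {v↔c}) + μ(T3 ∩ {v↔o}) + μ(T3 ∩ {o↔c})`. [folklore] -/
theorem real_obs_ge (w : Sym2 (Fin n) → unitInterval) (o u v c : Fin n) :
    (prodBernoulli w).real ((openConn u v)ᶜ ∩ openConn v o ∩ openConn v c : Set (BondConfig (Fin n))) +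
          (prodBernoulli w).real ((openConn u v)ᶜ ∩ ((openConn c u)ᶜ ∩ (openConn c v)ᶜ) ∩ openConn v o :
            Set (BondConfig (Fin n))) +
        (prodBernoulli w).real ((openConn u v)ᶜ ∩ ((openConn c u)ᶜ ∩ (openConn c v)ᶜ) ∩ openConn o c :
          Set (BondConfig (Fin n))) ≤
      (prodBernoulli w).real ((openConn u v)ᶜ ∩ (openConn c u)ᶜ ∩ (openConn v o ∪ openConn o c) :
        Set (BondConfig (Fin n))) := by
  rw [obs_eq o u v c]
  exact ThreePointTransfer.real_I_obs_ge w o u v c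

/-! ### The exchange step (Q) -/

/-- **(Q)** Guarded BHK for `S = {v}`, `T = {u, c}`, pair `(v, u)`: `{v↔o}` is of type `(+)` and `{u↔c}` of type `(−)`,
so `μ(Dcu ∩ v↔o) · μ(D ∩ v↮c) ≤ μ(D ∩ v↮c ∩ v↔o) · μ(Dcu)` (`{v↮u} ∩ {v↮c} = D ∩ {v↮c}`, and on it `{u↔c}` cuts
out `Dcu`), i.e. `P(v↔o | D, c↔u) ≤ P(v↔o | T3)`.
[cite: VandenbergHaggstromKahn2005, Thm. 1.3 (p. 6), Thm. 2.1 (p. 9) at q = 1] -/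
theorem stepQ (w : Sym2 (Fin n) → unitInterval) (o u v c : Fin n) :
    (prodBernoulli w).real ((openConn u v)ᶜ ∩ openConn c u ∩ openConn v o : Set (BondConfig (Fin n))) *
        (prodBernoulli w).real ((openConn u v)ᶜ ∩ (openConn v c)ᶜ : Set (BondConfig (Fin n))) ≤
      (prodBernoulli w).real ((openConn u v)ᶜ ∩ (openConn v c)ᶜ ∩ openConn v o : Set (BondConfig (Fin n))) *
        (prodBernoulli w).real ((openConn u v)ᶜ ∩ openConn c u : Set (BondConfig (Fin n))) := by
  have key := guardedTwoClusterExchange w ({v} : Set (Fin n)) ({u, c} : Set (Fin n)) (s := v) (t := u)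
    (by simp) (by simp)
    (A₁ := openConn v o) (A₂ := univ) (B₁ := openConn u c) (B₂ := univ)
    (typePlus_openConn v u o) (fun _ _ _ _ _ => mem_univ _)
    (typeMinus_openConn v u c) (fun _ _ _ _ _ => mem_univ _)
  simp only [ThreePointTransfer.sep_v_uc_eq, inter_univ] at key
  rw [Q_mid_eq o u v c, ThreePointTransfer.II_left_eq o u v c, Q_right_eq u v c,
    ThreePointTransfer.II_base_eq u v c] at key
  exact key

end FourPointTransfer

open FourPointTransfer in
/-- **Four-point transfer** (registered stub `stub_fourPointTransfer_c11`, line `tieline`, crux `AdditiveGluing`; lead c11):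
with `D = {u ↮ v}`, `F = D ∩ {c ↮ u}`, `T3 = D ∩ {c ↮ u} ∩ {c ↮ v}`, `Dcu = D ∩ {c ↔ u}`,
`μ(T3 ∩ {o↔c})·μ(F)·μ(Dcu) + μ(Dcu ∩ {v↔o})·μ(F)·μ(T3) ≤ μ(F ∩ ({v↔o} ∪ {o↔c}))·μ(T3)·μ(Dcu)`, i.e.
`P(o ↔ {v,c} | u ↮ {v,c}) ≥ P(o ↔ c | u, v, c pairwise separated) + P(o ↔ v | u ↮ v, u ↔ c)` — the instance
"`b` pendant to `c`" of the kernel (T_D).  From the three-point transfer `threePointTransfer`, one guarded two-cluster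
exchange (`FourPointTransfer.stepQ`) and linear arithmetic (`FourPointTransfer.alg`).
[cite: VandenbergHaggstromKahn2005, Thm. 1.3 (p. 6), Thm. 1.5 (p. 7), Thm. 2.1 (p. 9)] [cite: KozmaNitzan2024, Question 7 (p. 36)] -/
theorem stub_fourPointTransfer_c11 : ∀ (n : ℕ) (w : Sym2 (Fin n) → unitInterval) (o u v c : Fin n), (Literature.Probability.LatticeModels.prodBernoulli w).real ((Literature.Probability.Percolation.openConn u v)ᶜ ∩ ((Literature.Probability.Percolation.openConn c u)ᶜ ∩ (Literature.Probability.Percolation.openConn c v)ᶜ) ∩ Literature.Probability.Percolation.openConn o c : Set (Literature.Probability.Percolation.BondConfig (Fin n))) * (Literature.Probability.LatticeModels.prodBernoulli w).real ((Literature.Probability.Percolation.openConn u v)ᶜ ∩ (Literature.Probability.Percolation.openConn c u)ᶜ : Set (Literature.Probability.Percolation.BondConfig (Fin n))) * (Literature.Probability.LatticeModels.prodBernoulli w).real ((Literature.Probability.Percolation.openConn u v)ᶜ ∩ Literature.Probability.Percolation.openConn c u : Set (Literature.Probability.Percolation.BondConfig (Fin n))) + (Literature.Probability.LatticeModels.prodBernoulli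 w).real ((Literature.Probability.Percolation.openConn u v)ᶜ ∩ Literature.Probability.Percolation.openConn c u ∩ Literature.Probability.Percolation.openConn v o : Set (Literature.Probability.Percolation.BondConfig (Fin n))) * (Literature.Probability.LatticeModels.prodBernoulli w).real ((Literature.Probability.Percolation.openConn u v)ᶜ ∩ (Literature.Probability.Percolation.openConn c u)ᶜ : Set (Literature.Probability.Percolation.BondConfig (Fin n))) * (Literature.Probability.LatticeModels.prodBernoulli w).real ((Literature.Probability.Percolation.openConn u v)ᶜ ∩ ((Literature.Probability.Percolation.openConn c u)ᶜ ∩ (Literature.Probability.Percolation.openConn c v)ᶜ) : Set (Literature.Probability.Percolation.BondConfig (Fin n))) ≤ (Literature.Probability.LatticeModels.prodBernoulli w).real ((Literature.Probability.Percolation.openConn u v)ᶜ ∩ (Literature.Probability.Percolation.openConn c u)ᶜ ∩ (Literature.Probability.Percolation.openConn v o ∪ Literature.Probability.Percolation.openConn o c) : Set (Literature.Probability.Percolation.BondConfig (Fin n))) * (Literature.Probability.LatticeModels.prodBernoulli w).real ((Literature.Probability.Percolation.openConn u v)ᶜ ∩ ((Literature.Probability.Percolation.openConn c u)ᶜ ∩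 (Literature.Probability.Percolation.openConn c v)ᶜ) : Set (Literature.Probability.Percolation.BondConfig (Fin n))) * (Literature.Probability.LatticeModels.prodBernoulli w).real ((Literature.Probability.Percolation.openConn u v)ᶜ ∩ Literature.Probability.Percolation.openConn c u : Set (Literature.Probability.Percolation.BondConfig (Fin n))) := by
  intro n w o u v c
  have h3 := threePointTransfer n w o u v c
  obtain ⟨hD, hDo⟩ := ThreePointTransfer.real_D_split w o u v c
  have hQ := stepQ w o u v c
  have hcb := real_cb_split w u v c
  have hocb := real_ocb_split w o u v c
  have hge := real_obs_ge w o u v c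
  rw [hD, hDo, hcb, hocb] at h3
  rw [hcb, hocb] at hQ
  rw [real_F_split w u v c]
  refine alg ?_ ?_ ?_ h3 hQ hge <;> exact measureReal_nonneg

end

end Summit.CriticalPhenomena.PercolationContinuityZ3.Cruxes.AdditiveGluing.TieLine
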